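import Literature.Computability.Complexity.GateEliminationRules23

/-!
# Gate elimination, IX: moving the output, flipping a gate; Rules 2/3 at the output gate

Fifth layer of the toolkit for the one-step claim `LiYang2022_step` (Li–Yang, STOC 2022;
full version ECCC TR21-023, §3.3 Rule 3: "if `G` is the output gate, we make `I₁` the output gate
and change the function computed by `I₁` and its descendants properly"). Everything is PROVED.

* `Semicircuit.setOut v` — the same circuit with output node `v`; fairness, out-degrees,
  troubled gates, packings and the measure are unchanged; it computes `f|_R` when `v` carries
  the value of the old output on solutions (`ComputesRestr.setOut`).
* `Semicircuit.flipGate k₁` — gate `k₁` negated and every position reading it negated in turn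
  (`flipVals` on solutions); fairness, out-degrees, ∧-types, troubled gates, packings and the
  measure are unchanged, and `f|_R` is still computed if `k₁` is not the output.
* Output cases under the hypotheses of the one-step claim (an affine disperser for dimension
  `d` on a source of dimension `≥ 2d + 2`): an output gate fed by a constant is not trivialized
  (`out_ne_of_trivialized`), not fed by two constants (`out_ne_of_const_const`), and its live
  input is not a variable (`out_ne_of_live_var`) — by Prop. 2.4 as proved in
  `GateEliminationSubst.lean`; if it passes a gate (possibly negated) it is eliminated by
  `rule3_out_id` / `rule3_out_not` with `Δμ ≥ 1 - α_φ`; assembled as `rule23_out` and, with the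
  non-output case `rule23`, as **`rule23_any`**: any gate fed by a constant and not reading
  itself is eliminated with `Δμ ≥ 1 - α_φ`.

## References

* J. Li, T. Yang, *3.1n − o(n) circuit lower bounds for explicit functions*, STOC 2022
  [LiYang2022]; full version ECCC TR21-023, §3.3 (Rules 2, 3), Lemma 3.11, proof of Thm. 4.1.
-/

namespace Literature.Computability.Complexity

open Finset

/-- Negating the output of an ∧-type function gives an ∧-type function. [folklore] -/
theorem IsAndOp.not_comp {op : Bool → Bool → Bool} (h : IsAndOp op) : IsAndOp fun a b => !op a b := by
  obtain ⟨c₁, c₂, c₃, hc⟩ := h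
  refine ⟨c₁, c₂, !c₃, fun a b => ?_⟩
  show (!op a b) = _
  rw [hc]
  cases a <;> cases b <;> cases c₁ <;> cases c₂ <;> cases c₃ <;> rfl

/-- Negating the output of a ⊕-type function gives a ⊕-type function. [folklore] -/
theorem IsXorOp.not_comp {op : Bool → Bool → Bool} (h : IsXorOp op) : IsXorOp fun a b => !op a b := by
  obtain ⟨c, hc⟩ := h
  refine ⟨!c, fun a b => ?_⟩
  show (!op a b) = _
  rw [hc]
  cases a <;> cases b <;> cases c <;> rfl

/-- ∧-type is invariant under negating inputs (both directions). [folklore] -/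
theorem isAndOp_comp_xor_iff (op : Bool → Bool → Bool) (s₀ s₁ : Bool) :
    IsAndOp (fun a b => op (a ^^ s₀) (b ^^ s₁)) ↔ IsAndOp op := by
  refine ⟨fun h => ?_, fun h => h.comp_xor s₀ s₁⟩
  have hfun : (fun a b => op ((a ^^ s₀) ^^ s₀) ((b ^^ s₁) ^^ s₁)) = op := by
    funext a b
    rw [Bool.xor_assoc, Bool.xor_self, Bool.xor_false, Bool.xor_assoc, Bool.xor_self, Bool.xor_false]
  have := h.comp_xor s₀ s₁
  rwa [hfun] at this

/-- ∧-type is invariant under negating the output (both directions). [folklore] -/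
theorem isAndOp_not_comp_iff (op : Bool → Bool → Bool) : IsAndOp (fun a b => !op a b) ↔ IsAndOp op := by
  refine ⟨fun h => ?_, fun h => h.not_comp⟩
  have hfun : (fun a b => !!op a b) = op := by
    funext a b; exact Bool.not_not (op a b)
  have := h.not_comp
  rwa [hfun] at this

namespace Semicircuit

variable {n : ℕ} (C : Semicircuit n)

/-! ### Changing the output node -/

/-- **Moving the output** to the node `v` (Li–Yang §3.3, Rule 3: "if `G` is the output gate, we
make `I₁` the output gate"). [cite: LiYang2022, §3.3 (Rule 3)] -/
abbrev setOut (v : Node n C.m) : Semicircuit n where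
  m := C.m
  op := C.op
  arg := C.arg
  out := v
  xorPart := C.xorPart
  isXorOp_of_mem := C.isXorOp_of_mem
  mem_of_arg_eq := C.mem_of_arg_eq
  acyclic := C.acyclic

section SetOut

variable (v : Node n C.m)

/-- Node values are computed by the same function. [folklore] -/
theorem nodeVal_setOut_eq (x : Fin n → Bool) (w : Fin C.m → Bool) (u : Node n C.m) :
    (C.setOut v).nodeVal x w u = C.nodeVal x w u := by
  cases u <;> rfl

/-- Gate equations are unchanged. [folklore] -/
theorem consistent_setOut_iff (x : Fin n → Bool) (w : Fin C.m → Bool) :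
    (C.setOut v).Consistent x w ↔ C.Consistent x w := by
  unfold Consistent
  simp only [nodeVal_setOut_eq]

variable {C v} in
/-- Fairness is unchanged. [folklore] -/
theorem Fair.setOut (hF : C.Fair) : (C.setOut v).Fair := fun x => by
  obtain ⟨w, hw, huniq⟩ := hF x
  exact ⟨w, (C.consistent_setOut_iff v x w).mpr hw, fun w' hw' => huniq w' ((C.consistent_setOut_iff v x w').mp hw')⟩

/-- Out-degrees are unchanged. [folklore] -/
theorem fanout_setOut (u : Node n C.m) : (C.setOut v).fanout u = C.fanout u := rfl

/-- Troubled gates are unchanged. [folklore] -/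
theorem troubled_setOut_iff (k : Fin C.m) : (C.setOut v).Troubled k ↔ C.Troubled k := Iff.rfl

/-- Packings are unchanged. [folklore] -/
theorem isPacking_setOut_iff (P : Finset (Fin C.m × Fin C.m)) : (C.setOut v).IsPacking P ↔ C.IsPacking P :=
  Iff.rfl

/-- The measure is unchanged. [folklore] -/
theorem measure_setOut (αφ αI αQ : ℝ) (P : Finset (Fin C.m × Fin C.m)) (R : RdqSource n) :
    (C.setOut v).measure αφ αI αQ P R = C.measure αφ αI αQ P R := rfl

variable {C v} in
/-- **Moving the output to a node with the same value keeps computing `f|_R`.** [cite: LiYang2022, §3.3 (Rule 3)] -/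
theorem ComputesRestr.setOut {f : (Fin n → ZMod 2) → Bool} {R : RdqSource n} (hC : C.ComputesRestr f R)
    (hval : ∀ (x : Fin n → Bool) (w : Fin C.m → Bool), C.Consistent x w → C.nodeVal x w v = C.nodeVal x w C.out) :
    (C.setOut v).ComputesRestr f R := by
  refine ⟨fun i hi => hC.1 i hi, fun u hu w hw => ?_⟩
  rw [consistent_setOut_iff] at hw
  rw [nodeVal_setOut_eq]
  show C.nodeVal _ w v = f u
  rw [hval _ w hw]
  exact hC.2 u hu w hw

end SetOut

/-! ### Flipping a gate -/

/-- **Flipping the gate `k₁`**: its function is negated and every position reading it is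
negated in turn, so that all other gates keep their values (Li–Yang §3.3, Rule 3: "if `G` is the
output gate, we make `I₁` the output gate and change the function computed by `I₁` and its
descendants properly"). [cite: LiYang2022, §3.3 (Rule 3)] -/
abbrev flipGate (k₁ : Fin C.m) : Semicircuit n where
  m := C.m
  op k b₀ b₁ :=
    let r := C.op k (b₀ ^^ decide (C.arg k 0 = .gate k₁)) (b₁ ^^ decide (C.arg k 1 = .gate k₁))
    if k = k₁ then !r else r
  arg := C.arg
  out := C.out
  xorPart := C.xorPart
  isXorOp_of_mem k hk := by
    have h := (C.isXorOp_of_mem k hk).comp_xor (decide (C.arg k 0 = .gate k₁)) (decide (C.arg k 1 = .gate k₁))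
    by_cases hkk : k = k₁
    · simp only [hkk, if_true]
      subst hkk
      exact h.not_comp
    · simp only [hkk, if_false]
      exact h
  mem_of_arg_eq := C.mem_of_arg_eq
  acyclic := C.acyclic

section FlipGate

variable (k₁ : Fin C.m)

/-- Flipping the value at `k₁`. [folklore] -/
def flipVals (w : Fin C.m → Bool) : Fin C.m → Bool := Function.update w k₁ (!w k₁)

/-- `flipVals` is an involution. [folklore] -/
@[simp] theorem flipVals_flipVals (w : Fin C.m → Bool) : C.flipVals k₁ (C.flipVals k₁ w) = w := by
  funext k
  unfold flipVals
  by_cases hk : k = k₁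
  · subst hk; simp
  · simp [hk]

/-- `flipVals` at `k₁`. [folklore] -/
@[simp] theorem flipVals_self (w : Fin C.m → Bool) : C.flipVals k₁ w k₁ = !w k₁ := by
  simp [flipVals]

/-- `flipVals` elsewhere. [folklore] -/
theorem flipVals_of_ne (w : Fin C.m → Bool) {k : Fin C.m} (hk : k ≠ k₁) : C.flipVals k₁ w k = w k := by
  simp [flipVals, hk]

/-- Node values under flipped gate values, read through the compensating negation. [folklore] -/
theorem nodeVal_flipVals (x : Fin n → Bool) (w : Fin C.m → Bool) (u : Node n C.m) :
    (C.nodeVal x (C.flipVals k₁ w) u ^^ decide (u = .gate k₁)) = C.nodeVal x w u := by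
  cases u with
  | const b => simp [nodeVal]
  | var i => simp [nodeVal]
  | gate k =>
    by_cases hk : k = k₁
    · subst hk
      show (C.flipVals k w k ^^ decide (Node.gate k = Node.gate k)) = w k
      rw [flipVals_self, decide_eq_true rfl]
      cases w k <;> rfl
    · show (C.flipVals k₁ w k ^^ decide (Node.gate k = Node.gate k₁)) = w k
      rw [C.flipVals_of_ne k₁ w hk, decide_eq_false (fun h => hk (Node.gate.inj h)), Bool.xor_false]

/-- Node values are computed by the same function. [folklore] -/
theorem nodeVal_flipGate_eq (x : Fin n → Bool) (w : Fin C.m → Bool) (u : Node n C.m) :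
    (C.flipGate k₁).nodeVal x w u = C.nodeVal x w u := by
  cases u <;> rfl

/-- **Gate equations after flipping**: `w` solves the flipped circuit iff `w` with the value at
`k₁` negated solves `C`. [folklore] -/
theorem consistent_flipGate_iff (x : Fin n → Bool) (w : Fin C.m → Bool) :
    (C.flipGate k₁).Consistent x w ↔ C.Consistent x (C.flipVals k₁ w) := by
  unfold Consistent
  simp only [nodeVal_flipGate_eq]
  refine forall_congr' fun k => ?_
  have h0 := C.nodeVal_flipVals k₁ x w (C.arg k 0)
  have h1 := C.nodeVal_flipVals k₁ x w (C.arg k 1)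
  show (w k = (if k = k₁ then !(C.op k (C.nodeVal x w (C.arg k 0) ^^ decide (C.arg k 0 = .gate k₁))
      (C.nodeVal x w (C.arg k 1) ^^ decide (C.arg k 1 = .gate k₁))) else
      C.op k (C.nodeVal x w (C.arg k 0) ^^ decide (C.arg k 0 = .gate k₁))
        (C.nodeVal x w (C.arg k 1) ^^ decide (C.arg k 1 = .gate k₁)))) ↔ _
  -- rewrite the inputs of `op k` through `flipVals`
  have e0 : (C.nodeVal x w (C.arg k 0) ^^ decide (C.arg k 0 = .gate k₁)) =
      C.nodeVal x (C.flipVals k₁ w) (C.arg k 0) := by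
    rw [← h0]; cases C.nodeVal x (C.flipVals k₁ w) (C.arg k 0) <;> cases decide (C.arg k 0 = .gate k₁) <;> rfl
  have e1 : (C.nodeVal x w (C.arg k 1) ^^ decide (C.arg k 1 = .gate k₁)) =
      C.nodeVal x (C.flipVals k₁ w) (C.arg k 1) := by
    rw [← h1]; cases C.nodeVal x (C.flipVals k₁ w) (C.arg k 1) <;> cases decide (C.arg k 1 = .gate k₁) <;> rfl
  rw [e0, e1]
  by_cases hk : k = k₁
  · subst hk
    rw [if_pos rfl, flipVals_self]
    cases w k <;> cases C.op k _ _ <;> simp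
  · rw [if_neg hk, C.flipVals_of_ne k₁ w hk]

variable {C k₁} in
/-- **Flipping a gate preserves fairness** (solution sets correspond by `flipVals`). [folklore] -/
theorem Fair.flipGate (hF : C.Fair) : (C.flipGate k₁).Fair := fun x => by
  obtain ⟨w, hw, huniq⟩ := hF x
  refine ⟨C.flipVals k₁ w, (C.consistent_flipGate_iff k₁ x _).mpr (by rw [flipVals_flipVals]; exact hw),
    fun w' hw' => ?_⟩
  · replace hw' := (C.consistent_flipGate_iff k₁ x w').mp hw'
    have := huniq _ hw'
    rw [← C.flipVals_flipVals k₁ w', this]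

/-- Out-degrees are unchanged by flipping. [folklore] -/
theorem fanout_flipGate (u : Node n C.m) : (C.flipGate k₁).fanout u = C.fanout u := rfl

/-- ∧-types are unchanged by flipping. [folklore] -/
theorem isAndOp_flipGate_iff (k : Fin C.m) : IsAndOp ((C.flipGate k₁).op k) ↔ IsAndOp (C.op k) := by
  show IsAndOp (fun b₀ b₁ => if k = k₁ then !(C.op k (b₀ ^^ _) (b₁ ^^ _)) else C.op k (b₀ ^^ _) (b₁ ^^ _)) ↔ _
  by_cases hk : k = k₁
  · simp only [hk, if_true]
    rw [isAndOp_not_comp_iff (fun a b => C.op k₁ (a ^^ _) (b ^^ _)), isAndOp_comp_xor_iff]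
  · simp only [hk, if_false]
    rw [isAndOp_comp_xor_iff]

/-- Troubled gates are unchanged by flipping. [folklore] -/
theorem troubled_flipGate_iff (k : Fin C.m) : (C.flipGate k₁).Troubled k ↔ C.Troubled k := by
  unfold Troubled
  rw [isAndOp_flipGate_iff]
  rfl

/-- The troubled count is unchanged by flipping. [folklore] -/
theorem troubledCount_flipGate : (C.flipGate k₁).troubledCount = C.troubledCount := by
  classical
  unfold troubledCount
  exact congrArg Finset.card (filter_congr fun k _ => C.troubled_flipGate_iff k₁ k)

/-- Packings are unchanged by flipping. [folklore] -/
theorem isPacking_flipGate_iff (P : Finset (Fin C.m × Fin C.m)) : (C.flipGate k₁).IsPacking P ↔ C.IsPacking P := by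
  unfold IsPacking
  simp only [troubled_flipGate_iff]
  rfl

/-- The measure is unchanged by flipping. [folklore] -/
theorem measure_flipGate (αφ αI αQ : ℝ) (P : Finset (Fin C.m × Fin C.m)) (R : RdqSource n) :
    (C.flipGate k₁).measure αφ αI αQ P R = C.measure αφ αI αQ P R := by
  unfold measure potential influential
  rw [troubledCount_flipGate]
  rfl

variable {C k₁} in
/-- **Flipping a gate other than the output keeps computing `f|_R`.** [cite: LiYang2022, §3.3 (Rule 3)] -/
theorem ComputesRestr.flipGate {f : (Fin n → ZMod 2) → Bool} {R : RdqSource n} (hC : C.ComputesRestr f R)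
    (hout : C.out ≠ .gate k₁) : (C.flipGate k₁).ComputesRestr f R := by
  refine ⟨fun i hi => hC.1 i hi, fun u hu w hw => ?_⟩
  rw [consistent_flipGate_iff] at hw
  have := hC.2 u hu _ hw
  rw [nodeVal_flipGate_eq]
  show C.nodeVal _ w C.out = f u
  rw [← this]
  have h := C.nodeVal_flipVals k₁ (boolOfZMod2.symm u) w C.out
  rw [decide_eq_false hout, Bool.xor_false] at h
  exact h.symm

end FlipGate


/-! ### Rules 2/3 when the gate is the output -/

section OutputCases

variable {C}
variable {f : (Fin n → ZMod 2) → Bool} {R : RdqSource n} {d : ℕ} {k₀ : Fin C.m} {a₀ : Fin 2} {b : Bool}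

/-- **A trivialized gate is not the output** when the circuit computes an affine disperser for
dimension `d` on a source of dimension `≥ 2d` (the output would be constant on `Sol R`; Li–Yang:
"the function is not trivial after performing these substitutions, so the output gate of the
circuit will not be trivialized"). [cite: LiYang2022, proof of Thm. 4.1 (§4.1)] -/
theorem out_ne_of_trivialized (hf : IsAffineDisperser f d) (hd : 2 * d ≤ R.dim) (hF : C.Fair)
    (hC : C.ComputesRestr f R) (h₀ : C.arg k₀ a₀ = .const b)
    (htriv : C.liveFn k₀ a₀ b false = C.liveFn k₀ a₀ b true) : C.out ≠ .gate k₀ := by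
  intro hout
  obtain ⟨u, hu, v, hv, huv⟩ := hf.exists_ne_of_sol R hd
  have key : ∀ u ∈ R.Sol, f u = C.liveFn k₀ a₀ b false := by
    intro u hu
    obtain ⟨w, hw, -⟩ := hF (boolOfZMod2.symm u)
    have h1 := hC.2 u hu w hw
    rw [hout] at h1
    have h2 := hw k₀
    rw [op_eq_liveFn h₀] at h2
    rw [← h1]
    show w k₀ = _
    rw [h2]
    cases C.nodeVal (boolOfZMod2.symm u) w (C.arg k₀ a₀.rev)
    · rfl
    · exact htriv.symm
  exact huv ((key u hu).trans (key v hv).symm)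

/-- **A gate fed by two constants is not the output** (same reason). [cite: LiYang2022, proof of Thm. 4.1 (§4.1)] -/
theorem out_ne_of_const_const (hf : IsAffineDisperser f d) (hd : 2 * d ≤ R.dim) (hF : C.Fair)
    (hC : C.ComputesRestr f R) (h₀ : C.arg k₀ a₀ = .const b) {b' : Bool}
    (h₁ : C.arg k₀ a₀.rev = .const b') : C.out ≠ .gate k₀ := by
  intro hout
  obtain ⟨u, hu, v, hv, huv⟩ := hf.exists_ne_of_sol R hd
  have key : ∀ u ∈ R.Sol, f u = C.liveFn k₀ a₀ b b' := by
    intro u hu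
    obtain ⟨w, hw, -⟩ := hF (boolOfZMod2.symm u)
    have h1 := hC.2 u hu w hw
    rw [hout] at h1
    have h2 := hw k₀
    rw [op_eq_liveFn h₀, h₁] at h2
    rw [← h1]
    exact h2
  exact huv ((key u hu).trans (key v hv).symm)

/-- **A degenerate output gate whose live input is a variable is impossible** on a source of
dimension `≥ 2d + 2` (the output would be `x_i` or `¬ x_i` on `Sol R`). [cite: LiYang2022, proof of Thm. 4.1 (§4.1)] -/
theorem out_ne_of_live_var (hf : IsAffineDisperser f d) (hd : 2 * d + 2 ≤ R.dim) (hF : C.Fair)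
    (hC : C.ComputesRestr f R) (h₀ : C.arg k₀ a₀ = .const b) {i : Fin n}
    (h₁ : C.arg k₀ a₀.rev = .var i) : C.out ≠ .gate k₀ := by
  intro hout
  obtain ⟨u, hu, v, hv, hij, huv⟩ := hf.exists_ne_of_sol_coord R hd i
  have key : ∀ u ∈ R.Sol, f u = C.liveFn k₀ a₀ b (boolOfZMod2.symm u i) := by
    intro u hu
    obtain ⟨w, hw, -⟩ := hF (boolOfZMod2.symm u)
    have h1 := hC.2 u hu w hw
    rw [hout] at h1
    have h2 := hw k₀
    rw [op_eq_liveFn h₀, h₁] at h2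
    rw [← h1]
    exact h2
  have hi : boolOfZMod2.symm u i = boolOfZMod2.symm v i := by
    rw [Circuit.boolOfZMod2_symm_apply, Circuit.boolOfZMod2_symm_apply, hij]
  exact huv ((key u hu).trans (hi ▸ (key v hv).symm))

variable (C)

/-- The live function is unchanged by moving the output. [folklore] -/
theorem liveFn_setOut (v : Node n C.m) (k : Fin C.m) (a : Fin 2) (b : Bool) :
    (C.setOut v).liveFn k a b = C.liveFn k a b := rfl

variable {C}

/-- **Rule 3 for the output gate, identity case** (Li–Yang §3.3, Rule 3: "if `G` is the output
gate, we make `I₁` the output gate"): if the output gate is fed by a constant and passes its live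
input unnegated, move the output to the live input and apply Rule 3; `Δμ ≥ 1 - α_φ`.
[cite: LiYang2022, Lemma 3.11 (Rule 3)] -/
theorem rule3_out_id (hF : C.Fair) (hC : C.ComputesRestr f R) {P : Finset (Fin C.m × Fin C.m)}
    (hP : C.IsPacking P) (h₀ : C.arg k₀ a₀ = .const b) (hdeg : ∀ t, C.liveFn k₀ a₀ b t = t)
    (hself : ∀ a, C.arg k₀ a ≠ .gate k₀) (hout : C.out = .gate k₀)
    {αφ αI : ℝ} (hφ : 0 ≤ αφ) (hI : 0 ≤ αI) (αQ : ℝ) :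
    ∃ (C' : Semicircuit n) (P' : Finset (Fin C'.m × Fin C'.m)), C'.Fair ∧ C'.ComputesRestr f R ∧
      C'.IsPacking P' ∧ C'.m + 1 = C.m ∧
      C'.measure αφ αI αQ P' R ≤ C.measure αφ αI αQ P R - (1 - αφ) := by
  set v := C.arg k₀ a₀.rev with hvdef
  set C₂ := C.setOut v with hC₂
  have hval : ∀ (x : Fin n → Bool) (w : Fin C.m → Bool), C.Consistent x w →
      C.nodeVal x w v = C.nodeVal x w C.out := by
    intro x w hw
    rw [hout]
    show _ = w k₀
    rw [hw k₀, op_eq_liveFn h₀, hdeg]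
  have hF₂ : C₂.Fair := hF.setOut
  have hC₂ : C₂.ComputesRestr f R := hC.setOut hval
  have hP₂ : C₂.IsPacking P := (C.isPacking_setOut_iff v P).mpr hP
  have hout₂ : C₂.out ≠ .gate k₀ := hself a₀.rev
  have hdeg₂ : ∀ t, C₂.liveFn k₀ a₀ b t = (t ^^ false) := fun t => by
    rw [liveFn_setOut, hdeg, Bool.xor_false]
  obtain ⟨C', P', hF', hC', hP', hm, hμ⟩ :=
    C₂.rule3 (k₀ := k₀) (a₀ := a₀) false hF₂ hC₂ hP₂ h₀ hdeg₂ hself hout₂ hφ hI αQ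
  refine ⟨C', P', hF', hC', hP', hm, ?_⟩
  rw [C.measure_setOut] at hμ
  exact hμ

/-- The live function of `k₀` after flipping its live input gate `k₁ ≠ k₀`: the live input is
negated. [folklore] -/
theorem liveFn_flipGate_live {k₁ : Fin C.m} (h₀ : C.arg k₀ a₀ = .const b)
    (h₁ : C.arg k₀ a₀.rev = .gate k₁) (hk : k₀ ≠ k₁) (t : Bool) :
    (C.flipGate k₁).liveFn k₀ a₀ b t = C.liveFn k₀ a₀ b (!t) := by
  unfold liveFn
  show (if a₀ = 0 then (if k₀ = k₁ then _ else _) else (if k₀ = k₁ then _ else _)) = _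
  simp only [hk, if_false]
  obtain rfl | rfl : a₀ = 0 ∨ a₀ = 1 := by fin_cases a₀ <;> simp
  · have hr : (0 : Fin 2).rev = 1 := rfl
    rw [hr] at h₁
    rw [if_pos rfl, if_pos rfl, h₀, h₁, decide_eq_false (fun h => by cases h), decide_eq_true rfl]
    cases t <;> cases b <;> rfl
  · have hr : (1 : Fin 2).rev = 0 := rfl
    rw [hr] at h₁
    rw [if_neg (by decide), if_neg (by decide), h₀, h₁, decide_eq_true rfl,
      decide_eq_false (fun h => by cases h)]
    cases t <;> cases b <;> rfl

/-- **Rule 3 for the output gate, negation case** (Li–Yang §3.3, Rule 3: "… and change the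
function computed by `I₁` and its descendants properly"): if the output gate is fed by a
constant and outputs the negation of its live input, a gate `k₁`, flip `k₁` (compensating in its
readers), move the output to `k₁`, and apply Rule 3; `Δμ ≥ 1 - α_φ`. [cite: LiYang2022, Lemma 3.11 (Rule 3)] -/
theorem rule3_out_not (hF : C.Fair) (hC : C.ComputesRestr f R) {P : Finset (Fin C.m × Fin C.m)}
    (hP : C.IsPacking P) (h₀ : C.arg k₀ a₀ = .const b) {k₁ : Fin C.m} (h₁ : C.arg k₀ a₀.rev = .gate k₁)
    (hdeg : ∀ t, C.liveFn k₀ a₀ b t = !t) (hself : ∀ a, C.arg k₀ a ≠ .gate k₀) (hout : C.out = .gate k₀)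
    {αφ αI : ℝ} (hφ : 0 ≤ αφ) (hI : 0 ≤ αI) (αQ : ℝ) :
    ∃ (C' : Semicircuit n) (P' : Finset (Fin C'.m × Fin C'.m)), C'.Fair ∧ C'.ComputesRestr f R ∧
      C'.IsPacking P' ∧ C'.m + 1 = C.m ∧
      C'.measure αφ αI αQ P' R ≤ C.measure αφ αI αQ P R - (1 - αφ) := by
  have hk : k₀ ≠ k₁ := fun h => hself a₀.rev (by rw [h₁, h])
  set C₂ := C.flipGate k₁ with hC₂def
  have hF₂ : C₂.Fair := hF.flipGate
  have hC₂ : C₂.ComputesRestr f R := hC.flipGate (by rw [hout]; exact fun h => hk (Node.gate.inj h))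
  have hP₂ : C₂.IsPacking P := (C.isPacking_flipGate_iff k₁ P).mpr hP
  have hdeg₂ : ∀ t, C₂.liveFn k₀ a₀ b t = t := fun t => by
    show (C.flipGate k₁).liveFn k₀ a₀ b t = t
    rw [C.liveFn_flipGate_live h₀ h₁ hk, hdeg, Bool.not_not]
  obtain ⟨C', P', hF', hC', hP', hm, hμ⟩ :=
    rule3_out_id (C := C₂) hF₂ hC₂ hP₂ h₀ hdeg₂ hself hout hφ hI αQ
  refine ⟨C', P', hF', hC', hP', hm, ?_⟩
  have hμ₂ : C₂.measure αφ αI αQ P R = C.measure αφ αI αQ P R := C.measure_flipGate k₁ αφ αI αQ P R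
  linarith

/-- **Rules 2/3 at the output, assembled**: under the hypotheses of the one-step claim
(an affine disperser for dimension `d`, `dim R ≥ 2d + 2`), an output gate fed by a constant and
not reading itself can be eliminated with `Δμ ≥ 1 - α_φ` (it cannot be trivialized, nor pass a
variable or a constant; it passes a gate, possibly negated). [cite: LiYang2022, Lemma 3.11 (Rules 2, 3)] -/
theorem rule23_out (hf : IsAffineDisperser f d) (hd : 2 * d + 2 ≤ R.dim) (hF : C.Fair)
    (hC : C.ComputesRestr f R) {P : Finset (Fin C.m × Fin C.m)} (hP : C.IsPacking P)
    (h₀ : C.arg k₀ a₀ = .const b) (hself : ∀ a, C.arg k₀ a ≠ .gate k₀) (hout : C.out = .gate k₀)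
    {αφ αI : ℝ} (hφ : 0 ≤ αφ) (hI : 0 ≤ αI) (αQ : ℝ) :
    ∃ (C' : Semicircuit n) (P' : Finset (Fin C'.m × Fin C'.m)), C'.Fair ∧ C'.ComputesRestr f R ∧
      C'.IsPacking P' ∧ C'.m + 1 = C.m ∧
      C'.measure αφ αI αQ P' R ≤ C.measure αφ αI αQ P R - (1 - αφ) := by
  rcases bool_fn_const_or_xor (C.liveFn k₀ a₀ b) with htriv | hdeg
  · exact absurd hout (out_ne_of_trivialized hf (by omega) hF hC h₀ htriv)
  · cases hv : C.arg k₀ a₀.rev with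
    | const b' => exact absurd hout (out_ne_of_const_const hf (by omega) hF hC h₀ hv)
    | var i => exact absurd hout (out_ne_of_live_var hf hd hF hC h₀ hv)
    | gate k₁ =>
      cases hneg : C.liveFn k₀ a₀ b false with
      | false =>
        refine rule3_out_id hF hC hP h₀ (fun t => ?_) hself hout hφ hI αQ
        rw [hdeg, hneg, Bool.xor_false]
      | true =>
        refine rule3_out_not hF hC hP h₀ hv (fun t => ?_) hself hout hφ hI αQ
        rw [hdeg, hneg]
        cases t <;> rfl

/-- **Rules 2/3 for any gate fed by a constant**, output or not, under the hypotheses of the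
one-step claim. [cite: LiYang2022, Lemma 3.11 (Rules 2, 3)] -/
theorem rule23_any (hf : IsAffineDisperser f d) (hd : 2 * d + 2 ≤ R.dim) (hF : C.Fair)
    (hC : C.ComputesRestr f R) {P : Finset (Fin C.m × Fin C.m)} (hP : C.IsPacking P)
    (h₀ : C.arg k₀ a₀ = .const b) (hself : ∀ a, C.arg k₀ a ≠ .gate k₀)
    {αφ αI : ℝ} (hφ : 0 ≤ αφ) (hI : 0 ≤ αI) (αQ : ℝ) :
    ∃ (C' : Semicircuit n) (P' : Finset (Fin C'.m × Fin C'.m)), C'.Fair ∧ C'.ComputesRestr f R ∧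
      C'.IsPacking P' ∧ C'.m + 1 = C.m ∧
      C'.measure αφ αI αQ P' R ≤ C.measure αφ αI αQ P R - (1 - αφ) := by
  by_cases hout : C.out = .gate k₀
  · exact rule23_out hf hd hF hC hP h₀ hself hout hφ hI αQ
  · exact C.rule23 hF hC hP h₀ hself hout hφ hI αQ

end OutputCases
end Semicircuit

end Literature.Computability.Complexity
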